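import Summits.MatrixMultiplication.OmegaCensus.STPPVosperTilingWordsEnumExtract

/-!
# ω-census (abelian STPP census): SEMANTIC DEADNESS of a value pair `(Yo, Zo)` and its kernel certificates (words-cover rows)

HONEST FRAMING (pub-omega census; verbatim): lottery ticket; floor = certified bounds/negative ranges.
Census STRUCTURE (seat pub-omega-stpp-1 gen 33, 2026-08-28), family (b2).  The interface between the table-form slack-2 checkers
(`STPPVosperSlackTwoCheckersT.lean`: the leaf looks the pair `(Yo, Zo)` up in a table) and the words-cover rows that kill each table entry
(`existsCoverW … = false`, `STPPVosperTilingWords.lean`):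

* `CoverDead p N i szs Yo Zo` (a `Prop`): NO STPP family `(A, B, C)` of `ℤ/p` with `N` non-empty blocks whose blocks other than `i`, listed in some
  order `ks`, have the sizes `szs`, has `Yo` as the value list of `Y° = ⋃_{k≠i}(C_k − B_k)` and `Zo` as the value list of `Z° = ⋃_{k≠i}(C_k − A_k)`
  (duplicate-free lists; membership both ways);
* `coverDead_of_existsCoverW` : a row `existsCoverW p Yo Zo (szs.map fun s => bd Yo Zo s.1 s.2.1 s.2.2) [] [] [] = false` over ANY sound block
  enumerator `bd` (`BlockEnumSound p bd`: `blockDiffsW`, `blockDiffsWP`, `blockDiffsWQ`) certifies it (`existsCoverW_of_isSTPP_enum` with `u = 1`,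
  `y₀ = z₀ = 0`);
* `coverDead_of_existsCoverW_swapped` : so does the role-swapped row `existsCoverW p Zo Yo (szs.map fun s => bd Zo Yo s.2.1 s.1 s.2.2) [] [] [] = false`
  (`existsCoverW_both_of_isSTPP_enum`);
* `coverDead_forall_of_rows` / `…_swapped` : table versions (`∀ e ∈ tbl, …`).
The laws (`STPPVosperSlackTwoLawT.lean`) take `∀ e ∈ tbl, CoverDead p N i szs e.1 e.2` as the table hypothesis, so the cheapest sound orientation /
enumerator can be chosen per table.  UNCONDITIONAL; no `decide`.  Nothing here is progress on `ω`.

References: H. Cohn, R. Kleinberg, B. Szegedy, C. Umans, FOCS 2005 (arXiv:math/0511460), Def. 5.1.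
-/

open Finset
open scoped Pointwise

namespace Summit.MatrixMultiplication.OmegaCensus.CubeNB.S2

open Literature.Computability.AlgebraicComplexity
open Summit.MatrixMultiplication.OmegaCensus.STPPKneser

variable {p : ℕ} [hp : Fact p.Prime]

/-- **Semantic deadness of a value pair.**  `CoverDead p N i szs Yo Zo`: there is no STPP family of `ℤ/p` with `N` non-empty blocks, whose blocks
other than `i` (in some order `ks`) have sizes `szs`, with `Yo` the (duplicate-free) value list of `Y° = ⋃_{k≠i}(C_k − B_k)` and `Zo` that of
`Z° = ⋃_{k≠i}(C_k − A_k)`. [cite: CohnKleinbergSzegedyUmans2005, Def. 5.1] -/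
def CoverDead (p : ℕ) [Fact p.Prime] (N : ℕ) (i : Fin N) (szs : List (ℕ × ℕ × ℕ)) (Yo Zo : List ℕ) : Prop :=
  ∀ (A B C : Fin N → Finset (ZMod p)), IsSTPP A B C → (∀ k, (A k).Nonempty) → (∀ k, (B k).Nonempty) → (∀ k, (C k).Nonempty) →
    ∀ ks : List (Fin N), ks.Nodup → (∀ k, k ∈ ks ↔ k ≠ i) → ks.map (fun k => (#(A k), #(B k), #(C k))) = szs →
    Yo.Nodup → Zo.Nodup →
    (∀ v, v ∈ Yo ↔ ∃ x ∈ DU B C (univ.erase i), x.val = v) → (∀ v, v ∈ Zo ↔ ∃ x ∈ DU A C (univ.erase i), x.val = v) → False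

/-- **A words-cover row certifies deadness** (direct orientation, any sound enumerator, the blocks in the order of `szs`).
[cite: CohnKleinbergSzegedyUmans2005, Def. 5.1] -/
theorem coverDead_of_existsCoverW {bd : List ℕ → List ℕ → ℕ → ℕ → ℕ → List (List ℕ × List ℕ × List ℕ)} (hbd : BlockEnumSound p bd)
    {N : ℕ} {i : Fin N} {szs : List (ℕ × ℕ × ℕ)} {Yo Zo : List ℕ}
    (h : existsCoverW p Yo Zo (szs.map fun s => bd Yo Zo s.1 s.2.1 s.2.2) [] [] [] = false) : CoverDead p N i szs Yo Zo := by
  intro A B C hS hA hB hC ks hks hksi hszs hYnd _ hYo hZo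
  have key := existsCoverW_of_isSTPP_enum hbd hS hA hB hC i ks hks hksi (u := 1) (y₀ := 0) (z₀ := 0) one_ne_zero hYnd
    (fun x hx => (hYo _).2 ⟨x, hx, by rw [sub_zero, one_mul]⟩)
    (fun t ht => by obtain ⟨x, hx, hxv⟩ := (hYo t).1 ht; exact ⟨x, hx, by rw [sub_zero, one_mul, hxv]⟩)
    (fun x hx => (hZo _).2 ⟨x, hx, by rw [sub_zero, one_mul]⟩)
    (fun t ht => by obtain ⟨x, hx, hxv⟩ := (hZo t).1 ht; exact ⟨x, hx, by rw [sub_zero, one_mul, hxv]⟩)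
  rw [← hszs, List.map_map] at h
  have hfun : ((fun s : ℕ × ℕ × ℕ => bd Yo Zo s.1 s.2.1 s.2.2) ∘ fun k => (#(A k), #(B k), #(C k))) =
      fun k => bd Yo Zo #(A k) #(B k) #(C k) := rfl
  rw [hfun, key] at h
  exact Bool.noConfusion h

/-- **A role-swapped words-cover row certifies deadness** (`Z`-first: the family read as `(B, A, C)`, sizes `(b, a, c)` per block).
[cite: CohnKleinbergSzegedyUmans2005, Def. 5.1] -/
theorem coverDead_of_existsCoverW_swapped {bd : List ℕ → List ℕ → ℕ → ℕ → ℕ → List (List ℕ × List ℕ × List ℕ)}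
    (hbd : BlockEnumSound p bd) {N : ℕ} {i : Fin N} {szs : List (ℕ × ℕ × ℕ)} {Yo Zo : List ℕ}
    (h : existsCoverW p Zo Yo (szs.map fun s => bd Zo Yo s.2.1 s.1 s.2.2) [] [] [] = false) : CoverDead p N i szs Yo Zo := by
  intro A B C hS hA hB hC ks hks hksi hszs hYnd hZnd hYo hZo
  have key := (existsCoverW_both_of_isSTPP_enum hbd hS hA hB hC i ks hks hksi (u := 1) (y₀ := 0) (z₀ := 0) one_ne_zero hYnd hZnd
    (fun x hx => (hYo _).2 ⟨x, hx, by rw [sub_zero, one_mul]⟩)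
    (fun t ht => by obtain ⟨x, hx, hxv⟩ := (hYo t).1 ht; exact ⟨x, hx, by rw [sub_zero, one_mul, hxv]⟩)
    (fun x hx => (hZo _).2 ⟨x, hx, by rw [sub_zero, one_mul]⟩)
    (fun t ht => by obtain ⟨x, hx, hxv⟩ := (hZo t).1 ht; exact ⟨x, hx, by rw [sub_zero, one_mul, hxv]⟩)).2
  rw [← hszs, List.map_map] at h
  have hfun : ((fun s : ℕ × ℕ × ℕ => bd Zo Yo s.2.1 s.1 s.2.2) ∘ fun k => (#(A k), #(B k), #(C k))) =
      fun k => bd Zo Yo #(B k) #(A k) #(C k) := rfl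
  rw [hfun, key] at h
  exact Bool.noConfusion h

/-- Table form of `coverDead_of_existsCoverW`. [cite: CohnKleinbergSzegedyUmans2005, Def. 5.1] -/
theorem coverDead_forall_of_rows {bd : List ℕ → List ℕ → ℕ → ℕ → ℕ → List (List ℕ × List ℕ × List ℕ)} (hbd : BlockEnumSound p bd)
    {N : ℕ} {i : Fin N} {szs : List (ℕ × ℕ × ℕ)} {tbl : List (List ℕ × List ℕ)}
    (h : ∀ e ∈ tbl, existsCoverW p e.1 e.2 (szs.map fun s => bd e.1 e.2 s.1 s.2.1 s.2.2) [] [] [] = false) :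
    ∀ e ∈ tbl, CoverDead p N i szs e.1 e.2 :=
  fun e he => coverDead_of_existsCoverW hbd (h e he)

/-- Table form of `coverDead_of_existsCoverW_swapped`. [cite: CohnKleinbergSzegedyUmans2005, Def. 5.1] -/
theorem coverDead_forall_of_rows_swapped {bd : List ℕ → List ℕ → ℕ → ℕ → ℕ → List (List ℕ × List ℕ × List ℕ)}
    (hbd : BlockEnumSound p bd) {N : ℕ} {i : Fin N} {szs : List (ℕ × ℕ × ℕ)} {tbl : List (List ℕ × List ℕ)}
    (h : ∀ e ∈ tbl, existsCoverW p e.2 e.1 (szs.map fun s => bd e.2 e.1 s.2.1 s.1 s.2.2) [] [] [] = false) :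
    ∀ e ∈ tbl, CoverDead p N i szs e.1 e.2 :=
  fun e he => coverDead_of_existsCoverW_swapped hbd (h e he)

end Summit.MatrixMultiplication.OmegaCensus.CubeNB.S2
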